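import Summits.QuantumFields.YangMills.Theorems.UnitScaleTiltProp7MassiveConjugateResolventBound
import Summits.QuantumFields.YangMills.Theorems.UnitScaleTiltProp7ComplementaryProjectorColumns
import Summits.QuantumFields.YangMills.Theorems.UnitScaleTiltProp7GramConjAccretive
import Summits.QuantumFields.YangMills.Theorems.UnitScaleTiltProp7SiteEntryCoordinates
import HarnessLib

/-!
# Route `UnitScaleTilt`, crux K1 «MinimiserStabilityRegPr» (stmt-QuantumFields-19200), EX row `hGF[Lift]` ∕ `h349[Lift]` (curved member) — **LOD LINE BRICK (L5′-member), FILE B2b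
# (routeR-w2 g12, LOCATE-L5-GRAMSHELLS 7416633c road (G), chair-adopted 22:38:36Z): THE INVERSE COARSE GRAM MATRIX OF THE MASSIVE COLUMNS DECAYS — `‖M⁻¹ i i′‖ ≤ (m_B²∕2 − 3ε²)⁻¹·e^{−φ_c(y_c i)}`
# for every admissible Agmon weight pair — by ✓`Prop7GramConjAccretive` fed, through Parseval in px17's spike coordinates, with the conjugated-resolvent bound of ✓`…MassiveConjugateResolventBound`
# and the adjoint-side row `‖W T W_c⁻¹ − T‖ ≤ C_Tρ′` (§1).**

Cell `ym3-torus` (HUMAN RULING D-0037, YM ladder rung R3 — NOT d = 4, NOT infinite volume, NOT a mass gap, NOT Clay).  Width seat `ym-routeR-w2` gen 12 (D-0154 (3c); ★p1 g24 22:38:36Z ∕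
23:28:16Z; ★★OWNER RULINGS №33∕№35).  THEOREMS ONLY (0 `def`, 0 `sorry`); px5 g11's member letters VERBATIM + `G hAG hGA`; `--supports stmt-QuantumFields-19200 --as helper`, count-neutral.
HONEST LABEL (№33 (6)): curved γ-row ∕ (3.49) supplier line (LOD localisation), the coarse-Gram inverse decay in ABSTRACT-WEIGHT form (the exponential-in-`tdist` weights are px12 g13's B3);
CONDITIONAL on the coarse coercivity `hcoer` ((L4′), px10 g9's knit) and the window `3ε² < m_B²∕2`; nothing of (3.49), Thm 3.1∕3.3, `h349`, `hGF`, (L5″), EX ∕ 19200 is proved here.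

THE MATHEMATICS.  Columns `v i := G(T(b i))` over the coarse spike basis `b` (px17 ✓`orthonormal_spike` at the member level `n`), coordinates `B x i := ⟪b_f x, v i⟫` over the fine spike basis
`b_f`; `BᴴB = M` (✓`gram_eq_conjTranspose_mul_coords`).  A fine weight `w = e^{ψ∘site}` and a coarse weight `w_c = e^{φ_c∘σ∘site}` are DIAGONAL in the two spike bases, so the conjugated
column operator of ✓`re_conj_gram_ge` is, by Parseval, `Σ_x‖((B̃₊ − B)c)_x‖² = ‖W·G(T(W_c⁻¹f)) − G(T f)‖²` (`f = Σ c_i b_i`), and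
`W G T W_c⁻¹ − G T = (WGW⁻¹ − G)(WTW_c⁻¹) + G(WTW_c⁻¹ − T)`: the first factor is ✓`norm_weight_massive_inverse_sub_le` (`δ`), the second is §1 (`C_Tρ′`, by `hT`-duality and px5's
✓`topMean_blockConst_smul`).  Hence `ε = δ·C_T(1 + ρ′) + C_P²·C_Tρ′`, and ✓`gram_inv_entry_decay` concludes.

WHAT IS PROVED (ns `Summit.QuantumFields.YangMills.Theorems.Prop7CoarseGramInverseDecay`).
* §1 ★ `norm_weight_adjoint_sub_le` (`‖toL2S(w·T(ι(w_c⁻¹·c))) − T(ι c)‖ ≤ C_Tρ′‖ι c‖`), ★★ `norm_weight_column_op_sub_le` (`‖W·G(T(ι(w_c⁻¹c))) − G(T(ι c))‖ ≤ ε‖ι c‖`).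
* §2 (hypothesis-form spike bases `b_f`∕`b_c`: `hbf` = fine weights are diagonal, `hbc`∕`hcpl` = coarse basis vectors are lifts of one-block functions) `lift_coordSum_eq`,
  `weight_coordSum_eq` (coarse weights are diagonal), ★★ `hplus_of_weights` (the `hplus`∕`hminus` row of ✓`re_conj_gram_ge` at the member, either sign), `col_mulVec_eq_inner`.
* §3 ★★★ `norm_gram_inv_le_exp_neg_weight` (`‖M⁻¹ i i′‖ ≤ (m_B²∕2 − 3ε²)⁻¹·e^{−φ_c(y_c i)}` whenever `φ_c(y_c i′) = 0`; `m_B` = the coarse coercivity constant `hcoer`).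

References: T. Bałaban, CMP **99** (1985) 389–434 [Balaban1985BackgroundPropagators] ((3.16) p.393, (3.21)–(3.25) p.394, Thm 3.1 (3.46) p.398, (3.49) p.399); CMP **116** (1988) 1–22
[Balaban1988RG2Cluster] ((2.7) p.13); S. Agmon (1982) Ch. 1 [folklore].
-/

set_option autoImplicit false

noncomputable section

open scoped BigOperators Matrix.Norms.L2Operator InnerProductSpace ComplexConjugate Matrix

namespace Summit.QuantumFields.YangMills.Theorems.Prop7CoarseGramInverseDecay

open Literature.MathematicalPhysics.QuantumFieldTheory.Balaban1983to89
open Finset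
open T4Continuum BlockAveraging
open BlockAveraging (Idx)
open B7Prop1Explicit (U1 disp)
open B5Eq118OneStroke (iterBlockOf iterBlock)
open B10Eq27TorusAxialLog (holT transl)
open B7TransferAnalyticMean (meanCLM)
open B9Eq311L2Pairing (WL2)
open B11Eq103H1Complex (SiteL2K BondL2K)
open Summit.QuantumFields.YangMills.Theorems.Prop8Chart (emlIterU)
open Literature.MathematicalPhysics.QuantumFieldTheory.Balaban1983to89.T3ContinuumYM3Torus
open T3SectALandauChart (eta eta_pos bgUnits)
open T3PrintedRegularMinimiser (RegPr)
open T3PrintedRegularOrbits (sites_eq)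
open T3LevelShift (siteShift)
open Summit.QuantumFields.YangMills.Theorems.Prop7SectET3Transport (periodsT3)
open Summit.QuantumFields.YangMills.Theorems.Prop7SectET3HilbertLetters (W₂ toL2 toL2S DL2 DstarL2 covLapSite adjoint_DL2 inner_toL2)
open Summit.QuantumFields.YangMills.Theorems.Prop7SectET3RealCoordSums (inner_toL2S)
open Summit.QuantumFields.YangMills.Theorems.Prop7MassivePropagatorAgmonLetters (topMean_blockConst_smul inner_toL2S_smul_left norm_toL2S_smul_le)
open Summit.QuantumFields.YangMills.Theorems.Prop7MassiveConjugateResolvent (lift_topMean_weight_eq norm_weight_massive_inverse_sub_le)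
open Summit.QuantumFields.YangMills.Theorems.Prop7ComplementaryProjectorColumns (norm_adjoint_le)
open Summit.QuantumFields.YangMills.Theorems.Prop7GramConjAccretive (gram_inv_entry_decay)
open Summit.QuantumFields.YangMills.Theorems.Prop7SpanProjectorGramForm (gram_eq_conjTranspose_mul_coords)
open Summit.QuantumFields.YangMills.Theorems.Prop7SiteEntryCoordinates (orthonormal_spike top_le_span_spike inner_spike_toL2S norm_sq_sum_smul_orthonormalBasis)
open Literature.MathematicalPhysics.QuantumFieldTheory.Balaban1983to89.Beta.CombesThomasForm (abs_exp_sub_one_le)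

variable (F : T3Family) {n K : ℕ} (h : n ≤ K) {c₀ c₁ : ℝ} [Fact (0 < c₀)] [Fact (0 < c₁)]
  {ε₀ : ℝ} (hε₀ : 0 < ε₀) (hε7 : 10 ^ 7 * (F.L : ℝ) ^ 3 * ε₀ ≤ 1)
  (U₀ : GaugeField (F.P K) 0 (Matrix.specialUnitaryGroup (Fin 2) ℂ)) (hreg : RegPr F n K ε₀ U₀)
  (Q'' : SiteL2K ℂ 3 (periodsT3 F K) c₀ W₂ →ₗ[ℂ] (Site (F.P K) (K - n) → Matrix (Fin 2) (Fin 2) ℂ))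
  (hseq : ∀ lam : Site (F.P K) 0 → Matrix (Fin 2) (Fin 2) ℂ, ∃ ns : (j : ℕ) → Site (F.P K) j → Matrix (Fin 2) (Fin 2) ℂ, ns 0 = lam ∧
      (∀ (j : ℕ) (y : Site (F.P K) (j + 1)), ns (j + 1) y = ns j (emb y) - meanCLM (Idx (F.P K)) (Matrix (Fin 2) (Fin 2) ℂ) fun i : Idx (F.P K) =>
        ns j (emb y) - ((holT (emlIterU j (bgUnits F K U₀)) (emb y) (stairWord i.2.1 (off i.1)) : (Matrix (Fin 2) (Fin 2) ℂ)ˣ) : Matrix (Fin 2) (Fin 2) ℂ) *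
          ns j (transl (emb y) (disp (stairWord i.2.1 (off i.1)))) * (((holT (emlIterU j (bgUnits F K U₀)) (emb y) (stairWord i.2.1 (off i.1)))⁻¹ : (Matrix (Fin 2) (Fin 2) ℂ)ˣ) : Matrix (Fin 2) (Fin 2) ℂ)) ∧
      ns (K - n) = Q'' (toL2S F K c₀ lam))
  (ι : (Site (F.P K) (K - n) → Matrix (Fin 2) (Fin 2) ℂ) →ₗ[ℂ] SiteL2K ℂ 3 (periodsT3 F n) c₁ W₂)
  (hι : ∀ c, ι c = toL2S F n c₁ (fun z => c (siteShift (sites_eq F n K h) z)))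
  (T : SiteL2K ℂ 3 (periodsT3 F n) c₁ W₂ →ₗ[ℂ] SiteL2K ℂ 3 (periodsT3 F K) c₀ W₂)
  (hT : ∀ (l : SiteL2K ℂ 3 (periodsT3 F K) c₀ W₂) (f : SiteL2K ℂ 3 (periodsT3 F n) c₁ W₂), ⟪ι (Q'' l), f⟫_ℂ = ⟪l, T f⟫_ℂ)
  {a : ℝ} (ha : 0 < a)
  (G : SiteL2K ℂ 3 (periodsT3 F K) c₀ W₂ →ₗ[ℂ] SiteL2K ℂ 3 (periodsT3 F K) c₀ W₂)
  (hAG : ∀ f, covLapSite F n K c₀ U₀ (G f) + (a : ℂ) • T (ι (Q'' (G f))) = f)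
  (hGA : ∀ u, G (covLapSite F n K c₀ U₀ u + (a : ℂ) • T (ι (Q'' u))) = u)

/-! ## §1 The adjoint side: `‖W T W_c⁻¹ − T‖ ≤ C_Tρ′`, and the full weighted column operator -/

include hseq hι hT in
/-- ★ **THE WEIGHTED ADJOINT IS CLOSE TO THE ADJOINT**: for a site weight `w` and a nowhere-zero coarse weight `w_c` with in-block ratio `|w_c(B x)⁻¹w(x) − 1| ≤ ρ′`, and `‖ι(Q″λ)‖ ≤ C_T‖λ‖`:
`‖toL2S(w·T(ι(w_c⁻¹·c))) − T(ι c)‖ ≤ C_Tρ′·‖ι c‖` — by `hT`-duality the difference pairs with `toL2S l` as `⟪ι(Q″(r·l)), ι c⟫`, `r = w_c(B)⁻¹w − 1` (px5 ✓`topMean_blockConst_smul`).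
[cite: Balaban1985BackgroundPropagators, (3.16) p.393, (3.24) p.394] -/
theorem norm_weight_adjoint_sub_le (w : Site (F.P K) 0 → ℝ) (wc : Site (F.P K) (K - n) → ℝ) (hwc : ∀ y, wc y ≠ 0) {ρ' : ℝ} (hρ' : 0 ≤ ρ')
    (hr : ∀ x, |(wc (iterBlockOf (K - n) x))⁻¹ * w x - 1| ≤ ρ')
    {CT : ℝ} (hCT : 0 ≤ CT) (hCTb : ∀ l : SiteL2K ℂ 3 (periodsT3 F K) c₀ W₂, ‖ι (Q'' l)‖ ≤ CT * ‖l‖)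
    (c : Site (F.P K) (K - n) → Matrix (Fin 2) (Fin 2) ℂ) :
    ‖toL2S F K c₀ (fun x => w x • (toL2S F K c₀).symm (T (ι (fun y => (wc y)⁻¹ • c y))) x) - T (ι c)‖ ≤ CT * ρ' * ‖ι c‖ := by
  set d := toL2S F K c₀ (fun x => w x • (toL2S F K c₀).symm (T (ι (fun y => (wc y)⁻¹ • c y))) x) - T (ι c) with hd
  -- the pairing of the difference with any `toL2S l`
  have hpair : ∀ l : Site (F.P K) 0 → Matrix (Fin 2) (Fin 2) ℂ,
      ⟪toL2S F K c₀ l, d⟫_ℂ = ⟪ι (Q'' (toL2S F K c₀ (fun x => ((wc (iterBlockOf (K - n) x))⁻¹ * w x - 1) • l x))), ι c⟫_ℂ := by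
    intro l
    have h1 : ⟪toL2S F K c₀ l, toL2S F K c₀ (fun x => w x • (toL2S F K c₀).symm (T (ι (fun y => (wc y)⁻¹ • c y))) x)⟫_ℂ
        = ⟪ι (Q'' (toL2S F K c₀ (fun x => ((wc (iterBlockOf (K - n) x))⁻¹ * w x) • l x))), ι c⟫_ℂ := by
      rw [← inner_toL2S_smul_left, LinearEquiv.apply_symm_apply, ← hT, lift_topMean_weight_eq F h U₀ Q'' hseq ι hι w wc hwc l,
        hι (fun y => (wc y)⁻¹ • c y), hι c, hι (Q'' _), inner_toL2S_smul_left]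
      refine congrArg (fun v => ⟪_, toL2S F n c₁ v⟫_ℂ) (funext fun z => ?_)
      rw [smul_smul, mul_inv_cancel₀ (hwc _), one_smul]
    have h2 : ⟪toL2S F K c₀ l, T (ι c)⟫_ℂ = ⟪ι (Q'' (toL2S F K c₀ l)), ι c⟫_ℂ := (hT _ _).symm
    have hsplit : toL2S F K c₀ (fun x => ((wc (iterBlockOf (K - n) x))⁻¹ * w x) • l x)
        = toL2S F K c₀ l + toL2S F K c₀ (fun x => ((wc (iterBlockOf (K - n) x))⁻¹ * w x - 1) • l x) := by
      rw [← map_add]; congr 1; funext x; simp only [Pi.add_apply, sub_smul, one_smul, add_sub_cancel]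
    rw [hd, inner_sub_right, h1, h2, hsplit, map_add, map_add, inner_add_left, add_sub_cancel_left]
  -- test with `d` itself
  obtain ⟨l, hl⟩ : ∃ l : Site (F.P K) 0 → Matrix (Fin 2) (Fin 2) ℂ, toL2S F K c₀ l = d := ⟨(toL2S F K c₀).symm d, (toL2S F K c₀).apply_symm_apply d⟩
  have hsq : ‖d‖ ^ 2 ≤ CT * ρ' * ‖ι c‖ * ‖d‖ := by
    have h1 : (‖d‖ : ℝ) ^ 2 = RCLike.re ⟪d, d⟫_ℂ := by rw [inner_self_eq_norm_sq_to_K]; norm_cast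
    have h2 : ⟪d, d⟫_ℂ = ⟪toL2S F K c₀ l, d⟫_ℂ := by rw [hl]
    rw [h1, h2, hpair l, ← hl]
    calc RCLike.re ⟪ι (Q'' (toL2S F K c₀ (fun x => ((wc (iterBlockOf (K - n) x))⁻¹ * w x - 1) • l x))), ι c⟫_ℂ
        ≤ ‖ι (Q'' (toL2S F K c₀ (fun x => ((wc (iterBlockOf (K - n) x))⁻¹ * w x - 1) • l x)))‖ * ‖ι c‖ := (RCLike.re_le_norm _).trans (norm_inner_le_norm _ _)
      _ ≤ (CT * (ρ' * ‖toL2S F K c₀ l‖)) * ‖ι c‖ :=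
          mul_le_mul_of_nonneg_right ((hCTb _).trans (mul_le_mul_of_nonneg_left (norm_toL2S_smul_le F _ hρ' (fun x => hr x) l) hCT)) (norm_nonneg _)
      _ = CT * ρ' * ‖ι c‖ * ‖toL2S F K c₀ l‖ := by ring
  by_cases h0 : ‖d‖ = 0
  · rw [h0]; positivity
  · have hpos : 0 < ‖d‖ := lt_of_le_of_ne (norm_nonneg _) (Ne.symm h0)
    have : ‖d‖ * ‖d‖ ≤ (CT * ρ' * ‖ι c‖) * ‖d‖ := by rw [← sq]; exact hsq
    exact le_of_mul_le_mul_right this hpos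

include hε₀ hε7 hreg hseq hι hT ha hAG in
/-- ★★ **THE WEIGHTED COLUMN OPERATOR IS CLOSE TO THE COLUMN OPERATOR**: in px5's Agmon window and with `‖ι(Q″λ)‖ ≤ C_T‖λ‖`, `‖G f‖ ≤ C_G‖f‖`,
`‖toL2S(w·G(T(ι(w_c⁻¹·c)))) − G(T(ι c))‖ ≤ (δ·C_T(1 + ρ′) + C_G·C_Tρ′)·‖ι c‖` where `δ = C_P(2+C_P)·κ₁·(8C_P + 8C_P²)` is ✓`norm_weight_massive_inverse_sub_le`'s constant:
`W G T W_c⁻¹ − G T = (WGW⁻¹ − G)(WTW_c⁻¹) + G(WTW_c⁻¹ − T)`. [cite: Balaban1985BackgroundPropagators, Thm 3.1 (3.46) p.398, (3.24) p.394] -/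
theorem norm_weight_column_op_sub_le (w : Site (F.P K) 0 → ℝ) (hw : ∀ x, 0 < w x) (wc : Site (F.P K) (K - n) → ℝ) (hwc : ∀ y, 0 < wc y)
    {ρ ρ' : ℝ} (hρ : 0 ≤ ρ) (hρ' : 0 ≤ ρ')
    (hwρ : ∀ b : PBond (F.P K) 0, |w b.tgt / w b.src - 1| ≤ ρ ∧ |w b.src / w b.tgt - 1| ≤ ρ)
    (hwρ' : ∀ x : Site (F.P K) 0, |w x / wc (iterBlockOf (K - n) x) - 1| ≤ ρ' ∧ |wc (iterBlockOf (K - n) x) / w x - 1| ≤ ρ')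
    {δ₁ : ℝ} (hδ₁ : 0 ≤ δ₁)
    (hδ : 3 * ((eta F n K)⁻¹) ^ 2 * ρ ^ 2 + a * ((25 / 8) * (c₁ * ((((F.P K).L : ℝ) ^ (F.P K).d) ^ (K - n))⁻¹ / c₀)) * ρ' ^ 2 ≤ δ₁ ^ 2)
    (hwin : Real.sqrt (max 2 (16 * c₀ * ((F.L : ℝ) ^ (K - n)) ^ 3 / (a * c₁))) * δ₁ ≤ 1 / 10)
    {CT : ℝ} (hCT : 0 ≤ CT) (hCTb : ∀ l : SiteL2K ℂ 3 (periodsT3 F K) c₀ W₂, ‖ι (Q'' l)‖ ≤ CT * ‖l‖)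
    {CG : ℝ} (hCG : 0 ≤ CG) (hGn : ∀ f, ‖G f‖ ≤ CG * ‖f‖)
    (c : Site (F.P K) (K - n) → Matrix (Fin 2) (Fin 2) ℂ) :
    ‖toL2S F K c₀ (fun x => w x • (toL2S F K c₀).symm (G (T (ι (fun y => (wc y)⁻¹ • c y)))) x) - G (T (ι c))‖
      ≤ (Real.sqrt (max 2 (16 * c₀ * ((F.L : ℝ) ^ (K - n)) ^ 3 / (a * c₁))) * (2 + Real.sqrt (max 2 (16 * c₀ * ((F.L : ℝ) ^ (K - n)) ^ 3 / (a * c₁))))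
          * (Real.sqrt 3 * (eta F n K)⁻¹ * ρ + (Real.sqrt 3 * (eta F n K)⁻¹ * ρ) ^ 2 + Real.sqrt a * CT * ρ' + a * CT ^ 2 * ρ' ^ 2)
          * (8 * Real.sqrt (max 2 (16 * c₀ * ((F.L : ℝ) ^ (K - n)) ^ 3 / (a * c₁))) + 8 * Real.sqrt (max 2 (16 * c₀ * ((F.L : ℝ) ^ (K - n)) ^ 3 / (a * c₁))) ^ 2)
          * (CT * (1 + ρ')) + CG * (CT * ρ')) * ‖ι c‖ := by
  have hw0 : ∀ x, w x ≠ 0 := fun x => (hw x).ne'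
  have hwc0 : ∀ y, wc y ≠ 0 := fun y => (hwc y).ne'
  -- the weighted source `w₀ := w · T(ι(w_c⁻¹ c))`
  set t : Site (F.P K) 0 → Matrix (Fin 2) (Fin 2) ℂ := (toL2S F K c₀).symm (T (ι (fun y => (wc y)⁻¹ • c y))) with ht_def
  have ht : toL2S F K c₀ t = T (ι (fun y => (wc y)⁻¹ • c y)) := (toL2S F K c₀).apply_symm_apply _
  set w₀ : Site (F.P K) 0 → Matrix (Fin 2) (Fin 2) ℂ := fun x => w x • t x with hw₀
  -- the adjoint-side row
  have hCTb' : ∀ v : Site (F.P K) 0 → Matrix (Fin 2) (Fin 2) ℂ, ‖ι (Q'' (toL2S F K c₀ v))‖ ≤ CT * ‖toL2S F K c₀ v‖ := fun v => hCTb _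
  have hr : ∀ x, |(wc (iterBlockOf (K - n) x))⁻¹ * w x - 1| ≤ ρ' := fun x => by rw [inv_mul_eq_div]; exact (hwρ' x).1
  have hadj : ‖toL2S F K c₀ w₀ - T (ι c)‖ ≤ CT * ρ' * ‖ι c‖ := norm_weight_adjoint_sub_le F h U₀ Q'' hseq ι hι T hT w wc hwc0 hρ' hr hCT hCTb c
  have hT0 : ‖T (ι c)‖ ≤ CT * ‖ι c‖ := norm_adjoint_le F Q'' ι T hT hCT hCTb (ι c)
  have hw₀n : ‖toL2S F K c₀ w₀‖ ≤ CT * (1 + ρ') * ‖ι c‖ := by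
    calc ‖toL2S F K c₀ w₀‖ = ‖(toL2S F K c₀ w₀ - T (ι c)) + T (ι c)‖ := by rw [sub_add_cancel]
      _ ≤ ‖toL2S F K c₀ w₀ - T (ι c)‖ + ‖T (ι c)‖ := norm_add_le _ _
      _ ≤ CT * ρ' * ‖ι c‖ + CT * ‖ι c‖ := add_le_add hadj hT0
      _ = CT * (1 + ρ') * ‖ι c‖ := by ring
  -- the conjugated resolvent on `w₀`
  have hres := norm_weight_massive_inverse_sub_le F h hε₀ hε7 U₀ hreg Q'' hseq ι hι T hT ha G hAG w hw wc hwc hρ hρ' hwρ hwρ' hδ₁ hδ hwin hCT hCTb' w₀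
  have hsrc : (fun x => (w x)⁻¹ • w₀ x) = t := by funext x; rw [hw₀]; simp only; rw [smul_smul, inv_mul_cancel₀ (hw0 x), one_smul]
  rw [hsrc, ht] at hres
  -- assemble
  set δ : ℝ := Real.sqrt (max 2 (16 * c₀ * ((F.L : ℝ) ^ (K - n)) ^ 3 / (a * c₁))) * (2 + Real.sqrt (max 2 (16 * c₀ * ((F.L : ℝ) ^ (K - n)) ^ 3 / (a * c₁))))
      * (Real.sqrt 3 * (eta F n K)⁻¹ * ρ + (Real.sqrt 3 * (eta F n K)⁻¹ * ρ) ^ 2 + Real.sqrt a * CT * ρ' + a * CT ^ 2 * ρ' ^ 2)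
      * (8 * Real.sqrt (max 2 (16 * c₀ * ((F.L : ℝ) ^ (K - n)) ^ 3 / (a * c₁))) + 8 * Real.sqrt (max 2 (16 * c₀ * ((F.L : ℝ) ^ (K - n)) ^ 3 / (a * c₁))) ^ 2) with hδ_def
  have hη : 0 < eta F n K := eta_pos F n K
  have hδ0 : 0 ≤ δ := by rw [hδ_def]; positivity
  have hres' : ‖toL2S F K c₀ (fun x => w x • (toL2S F K c₀).symm (G (T (ι (fun y => (wc y)⁻¹ • c y)))) x) - G (toL2S F K c₀ w₀)‖ ≤ δ * ‖toL2S F K c₀ w₀‖ :=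
    hres.trans (le_of_eq (by rw [hδ_def]; ring))
  calc ‖toL2S F K c₀ (fun x => w x • (toL2S F K c₀).symm (G (T (ι (fun y => (wc y)⁻¹ • c y)))) x) - G (T (ι c))‖
      = ‖(toL2S F K c₀ (fun x => w x • (toL2S F K c₀).symm (G (T (ι (fun y => (wc y)⁻¹ • c y)))) x) - G (toL2S F K c₀ w₀)) + G (toL2S F K c₀ w₀ - T (ι c))‖ := by
        rw [map_sub, sub_add_sub_cancel]
    _ ≤ ‖toL2S F K c₀ (fun x => w x • (toL2S F K c₀).symm (G (T (ι (fun y => (wc y)⁻¹ • c y)))) x) - G (toL2S F K c₀ w₀)‖ + ‖G (toL2S F K c₀ w₀ - T (ι c))‖ := norm_add_le _ _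
    _ ≤ δ * ‖toL2S F K c₀ w₀‖ + CG * ‖toL2S F K c₀ w₀ - T (ι c)‖ := add_le_add hres' (hGn _)
    _ ≤ δ * (CT * (1 + ρ') * ‖ι c‖) + CG * (CT * ρ' * ‖ι c‖) := add_le_add (mul_le_mul_of_nonneg_left hw₀n hδ0) (mul_le_mul_of_nonneg_left hadj hCG)
    _ = (δ * (CT * (1 + ρ')) + CG * (CT * ρ')) * ‖ι c‖ := by ring

/-! ## §2 Coordinates: spike-like bases diagonalise the weights; the `hplus`∕`hminus` rows of ✓`re_conj_gram_ge` -/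

section Coordinates

variable {ιf ιc : Type*} [Fintype ιf] [Fintype ιc] [DecidableEq ιc]
  (bf : OrthonormalBasis ιf ℂ (SiteL2K ℂ 3 (periodsT3 F K) c₀ W₂)) (xf : ιf → Site (F.P K) 0)
  (hbf : ∀ (x : ιf) (w : Site (F.P K) 0 → ℝ) (g : Site (F.P K) 0 → Matrix (Fin 2) (Fin 2) ℂ),
    ⟪bf x, toL2S F K c₀ (fun s => w s • g s)⟫_ℂ = (w (xf x) : ℂ) * ⟪bf x, toL2S F K c₀ g⟫_ℂ)
  (bc : OrthonormalBasis ιc ℂ (SiteL2K ℂ 3 (periodsT3 F n) c₁ W₂)) (cpl : ιc → Site (F.P K) (K - n) → Matrix (Fin 2) (Fin 2) ℂ)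
  (yc : ιc → Site (F.P K) (K - n)) (hbc : ∀ i, bc i = ι (cpl i))
  (hcpl : ∀ (i : ιc) (g : Site (F.P K) (K - n) → ℝ), (fun y => g y • cpl i y) = fun y => g (yc i) • cpl i y)

include hbc in
omit [DecidableEq ιc] in
/-- The plain coarse function of a coordinate vector: `ι(Σ_i c′_i·cpl_i) = Σ_i c′_i • bc i`. [cite: Balaban1985BackgroundPropagators, (3.16) p.393] -/
theorem lift_coordSum_eq (c' : ιc → ℂ) : ι (∑ i, c' i • cpl i) = ∑ i, c' i • bc i := by
  rw [map_sum]; exact Finset.sum_congr rfl fun i _ => by rw [map_smul, hbc]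

include hcpl in
omit [DecidableEq ιc] in
/-- Coarse weights are diagonal on spike-like columns: `g·(Σ c′_i cpl_i) = Σ (g(y_i)c′_i)·cpl_i`. [cite: Balaban1985BackgroundPropagators, (3.16) p.393] -/
theorem weight_coordSum_eq (g : Site (F.P K) (K - n) → ℝ) (c' : ιc → ℂ) :
    (fun y => g y • (∑ i, c' i • cpl i) y) = ∑ i, ((g (yc i) : ℂ) * c' i) • cpl i := by
  funext y
  rw [Finset.sum_apply, Finset.sum_apply, Finset.smul_sum]
  refine Finset.sum_congr rfl fun i _ => ?_
  have h := congrFun (hcpl i g) y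
  rw [Pi.smul_apply, Pi.smul_apply, smul_comm, h, mul_smul, Complex.coe_smul, smul_comm]

include hε₀ hε7 hreg hseq hι hT ha hAG hbf hbc hcpl in
omit [DecidableEq ιc] in
set_option maxHeartbeats 400000 in
/-- ★★ **THE `hplus` ROW OF ✓`re_conj_gram_ge` AT THE MEMBER** (and `hminus`, by applying it to the reciprocal weights): with `B x i := ⟪b_f x, G(T(b_c i))⟫`, fine log-weight
`ψ x := φ(x_f x)`, coarse log-weight `φ′ i := φ_c(y_c i)`, px5's window for `w = e^{φ}`, `w_c = e^{φ_c}`, and `‖G‖ ≤ C_G`: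
`Σ_x‖((B̃₊ − B)c′)_x‖² ≤ ε²·Σ_i‖c′_i‖²`, `ε = δ·C_T(1+ρ′) + C_G·C_Tρ′` (§1; Parseval in `b_f`, orthonormality of `b_c`). [cite: Balaban1985BackgroundPropagators, Thm 3.1 (3.46) p.398; Balaban1988RG2Cluster, (2.7) p.13] -/
theorem hplus_of_weights (φ : Site (F.P K) 0 → ℝ) (φc : Site (F.P K) (K - n) → ℝ)
    {ρ ρ' : ℝ} (hρ : 0 ≤ ρ) (hρ' : 0 ≤ ρ')
    (hwρ : ∀ b : PBond (F.P K) 0, |Real.exp (φ b.tgt) / Real.exp (φ b.src) - 1| ≤ ρ ∧ |Real.exp (φ b.src) / Real.exp (φ b.tgt) - 1| ≤ ρ)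
    (hwρ' : ∀ x : Site (F.P K) 0, |Real.exp (φ x) / Real.exp (φc (iterBlockOf (K - n) x)) - 1| ≤ ρ' ∧ |Real.exp (φc (iterBlockOf (K - n) x)) / Real.exp (φ x) - 1| ≤ ρ')
    {δ₁ : ℝ} (hδ₁ : 0 ≤ δ₁)
    (hδ : 3 * ((eta F n K)⁻¹) ^ 2 * ρ ^ 2 + a * ((25 / 8) * (c₁ * ((((F.P K).L : ℝ) ^ (F.P K).d) ^ (K - n))⁻¹ / c₀)) * ρ' ^ 2 ≤ δ₁ ^ 2)
    (hwin : Real.sqrt (max 2 (16 * c₀ * ((F.L : ℝ) ^ (K - n)) ^ 3 / (a * c₁))) * δ₁ ≤ 1 / 10)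
    {CT : ℝ} (hCT : 0 ≤ CT) (hCTb : ∀ l : SiteL2K ℂ 3 (periodsT3 F K) c₀ W₂, ‖ι (Q'' l)‖ ≤ CT * ‖l‖)
    {CG : ℝ} (hCG : 0 ≤ CG) (hGn : ∀ f, ‖G f‖ ≤ CG * ‖f‖) (c' : ιc → ℂ) :
    ∑ x, ‖((Matrix.of fun x i => (Real.exp (φ (xf x) - φc (yc i)) : ℂ) * ⟪bf x, G (T (bc i))⟫_ℂ) *ᵥ c') x
        - ((Matrix.of fun x i => ⟪bf x, G (T (bc i))⟫_ℂ) *ᵥ c') x‖ ^ 2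
      ≤ ((Real.sqrt (max 2 (16 * c₀ * ((F.L : ℝ) ^ (K - n)) ^ 3 / (a * c₁))) * (2 + Real.sqrt (max 2 (16 * c₀ * ((F.L : ℝ) ^ (K - n)) ^ 3 / (a * c₁))))
          * (Real.sqrt 3 * (eta F n K)⁻¹ * ρ + (Real.sqrt 3 * (eta F n K)⁻¹ * ρ) ^ 2 + Real.sqrt a * CT * ρ' + a * CT ^ 2 * ρ' ^ 2)
          * (8 * Real.sqrt (max 2 (16 * c₀ * ((F.L : ℝ) ^ (K - n)) ^ 3 / (a * c₁))) + 8 * Real.sqrt (max 2 (16 * c₀ * ((F.L : ℝ) ^ (K - n)) ^ 3 / (a * c₁))) ^ 2)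
          * (CT * (1 + ρ')) + CG * (CT * ρ'))) ^ 2 * ∑ i, ‖c' i‖ ^ 2 := by
  -- the plain coarse function and its weighted version
  set cf : Site (F.P K) (K - n) → Matrix (Fin 2) (Fin 2) ℂ := ∑ i, c' i • cpl i with hcf
  have hιcf : ι cf = ∑ i, c' i • bc i := lift_coordSum_eq F (ι := ι) (bc := bc) (cpl := cpl) hbc c'
  have hwcf : (fun y => (Real.exp (φc y))⁻¹ • cf y) = ∑ i, ((Real.exp (-φc (yc i)) : ℂ) * c' i) • cpl i := by
    have h1 := weight_coordSum_eq F (cpl := cpl) (yc := yc) hcpl (fun y => (Real.exp (φc y))⁻¹) c'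
    rw [hcf]
    refine h1.trans (Finset.sum_congr rfl fun i _ => ?_)
    rw [Real.exp_neg]
  -- the two columns read through `b_f`
  set Dv := toL2S F K c₀ (fun s => Real.exp (φ s) • (toL2S F K c₀).symm (G (T (ι (fun y => (Real.exp (φc y))⁻¹ • cf y)))) s) - G (T (ι cf)) with hDv
  have hcoord : ∀ x, ((Matrix.of fun x i => (Real.exp (φ (xf x) - φc (yc i)) : ℂ) * ⟪bf x, G (T (bc i))⟫_ℂ) *ᵥ c') x
      - ((Matrix.of fun x i => ⟪bf x, G (T (bc i))⟫_ℂ) *ᵥ c') x = ⟪bf x, Dv⟫_ℂ := by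
    intro x
    -- unweighted column
    have hB : ((Matrix.of fun x i => ⟪bf x, G (T (bc i))⟫_ℂ) *ᵥ c') x = ⟪bf x, G (T (ι cf))⟫_ℂ := by
      rw [hιcf, map_sum, map_sum, inner_sum]
      simp only [Matrix.mulVec, dotProduct, Matrix.of_apply]
      exact Finset.sum_congr rfl fun i _ => by rw [map_smul, map_smul, inner_smul_right, mul_comm]
    -- weighted column
    have hBw : ((Matrix.of fun x i => (Real.exp (φ (xf x) - φc (yc i)) : ℂ) * ⟪bf x, G (T (bc i))⟫_ℂ) *ᵥ c') x
        = ⟪bf x, toL2S F K c₀ (fun s => Real.exp (φ s) • (toL2S F K c₀).symm (G (T (ι (fun y => (Real.exp (φc y))⁻¹ • cf y)))) s)⟫_ℂ := by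
      rw [hbf, LinearEquiv.apply_symm_apply, hwcf, map_sum, map_sum, map_sum, inner_sum, Finset.mul_sum]
      simp only [Matrix.mulVec, dotProduct, Matrix.of_apply]
      refine Finset.sum_congr rfl fun i _ => ?_
      rw [map_smul, ← hbc, map_smul, map_smul, inner_smul_right, Real.exp_sub, Complex.ofReal_div, Real.exp_neg, Complex.ofReal_inv]
      have hne : (Real.exp (φc (yc i)) : ℂ) ≠ 0 := by exact_mod_cast (Real.exp_pos _).ne'
      field_simp
    rw [hBw, hB, ← inner_sub_right]
  -- Parseval + the operator bound of §1
  have hpars : ∑ x, ‖⟪bf x, Dv⟫_ℂ‖ ^ 2 = ‖Dv‖ ^ 2 := bf.sum_sq_norm_inner_right Dv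
  have hop := norm_weight_column_op_sub_le F h hε₀ hε7 U₀ hreg Q'' hseq ι hι T hT ha G hAG (fun s => Real.exp (φ s)) (fun s => Real.exp_pos _)
    (fun y => Real.exp (φc y)) (fun y => Real.exp_pos _) hρ hρ' hwρ hwρ' hδ₁ hδ hwin hCT hCTb hCG hGn cf
  rw [← hDv] at hop
  have hnorm : ‖ι cf‖ ^ 2 = ∑ i, ‖c' i‖ ^ 2 := by rw [hιcf, norm_sq_sum_smul_orthonormalBasis]
  calc ∑ x, ‖((Matrix.of fun x i => (Real.exp (φ (xf x) - φc (yc i)) : ℂ) * ⟪bf x, G (T (bc i))⟫_ℂ) *ᵥ c') x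
          - ((Matrix.of fun x i => ⟪bf x, G (T (bc i))⟫_ℂ) *ᵥ c') x‖ ^ 2
      = ∑ x, ‖⟪bf x, Dv⟫_ℂ‖ ^ 2 := Finset.sum_congr rfl fun x _ => by rw [hcoord]
    _ = ‖Dv‖ ^ 2 := hpars
    _ ≤ (_ * ‖ι cf‖) ^ 2 := pow_le_pow_left₀ (norm_nonneg _) hop 2
    _ = _ := by rw [mul_pow, hnorm]

omit [DecidableEq ιc] in
/-- The coordinate column operator: `(B c′)_x = ⟪b_f x, G(T(Σ c′_i • b_c i))⟫`. [cite: Balaban1985BackgroundPropagators, (3.21) p.394] -/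
theorem col_mulVec_eq_inner (c' : ιc → ℂ) (x : ιf) :
    ((Matrix.of fun x i => ⟪bf x, G (T (bc i))⟫_ℂ) *ᵥ c') x = ⟪bf x, G (T (∑ i, c' i • bc i))⟫_ℂ := by
  rw [map_sum, map_sum, inner_sum]
  simp only [Matrix.mulVec, dotProduct, Matrix.of_apply]
  exact Finset.sum_congr rfl fun i _ => by rw [map_smul, map_smul, inner_smul_right, mul_comm]

/-! ## §3 The inverse Gram matrix decays -/

include hε₀ hε7 hreg hseq hι hT ha hAG hbf hbc hcpl in
set_option maxHeartbeats 400000 in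
/-- ★★★ **THE INVERSE COARSE GRAM MATRIX OF THE MASSIVE COLUMNS DECAYS IN EVERY ADMISSIBLE AGMON WEIGHT**: with `M i i′ = ⟪G(T(b_c i)), G(T(b_c i′))⟫`, coarse coercivity
`m_B‖f‖ ≤ ‖G(T f)‖` (`m_B > 0`, (L4′)), an admissible pair `(φ, φ_c)` in px5's window (both signs), `‖ι(Q″λ)‖ ≤ C_T‖λ‖`, `‖G‖ ≤ C_G`, and the window `3ε² < m_B²∕2`:
`‖M⁻¹ i i′‖ ≤ (m_B²∕2 − 3ε²)⁻¹ · e^{−φ_c(y_c i)}` whenever `φ_c(y_c i′) = 0` — ✓`Prop7GramConjAccretive.gram_inv_entry_decay` fed with §2 (Parseval ✓`gram_eq_conjTranspose_mul_coords`).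
With B3's weights `φ_c = μ″·tdist(·, y_c i′)` this is `‖M⁻¹ i i′‖ ≤ C_N e^{−μ″ tdist}` — the `hN` of ✓`norm_form_sandwich_le_exp` ∕ ✓`norm_inner_starProjection_le_exp`, K-uniformly.
[cite: Balaban1985BackgroundPropagators, (3.49) p.399; Balaban1988RG2Cluster, (2.7) p.13] -/
theorem norm_gram_inv_le_exp_neg_weight (φ : Site (F.P K) 0 → ℝ) (φc : Site (F.P K) (K - n) → ℝ)
    {ρ ρ' : ℝ} (hρ : 0 ≤ ρ) (hρ' : 0 ≤ ρ')
    (hwρ : ∀ b : PBond (F.P K) 0, |Real.exp (φ b.tgt) / Real.exp (φ b.src) - 1| ≤ ρ ∧ |Real.exp (φ b.src) / Real.exp (φ b.tgt) - 1| ≤ ρ)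
    (hwρ' : ∀ x : Site (F.P K) 0, |Real.exp (φ x) / Real.exp (φc (iterBlockOf (K - n) x)) - 1| ≤ ρ' ∧ |Real.exp (φc (iterBlockOf (K - n) x)) / Real.exp (φ x) - 1| ≤ ρ')
    {δ₁ : ℝ} (hδ₁ : 0 ≤ δ₁)
    (hδ : 3 * ((eta F n K)⁻¹) ^ 2 * ρ ^ 2 + a * ((25 / 8) * (c₁ * ((((F.P K).L : ℝ) ^ (F.P K).d) ^ (K - n))⁻¹ / c₀)) * ρ' ^ 2 ≤ δ₁ ^ 2)
    (hwin : Real.sqrt (max 2 (16 * c₀ * ((F.L : ℝ) ^ (K - n)) ^ 3 / (a * c₁))) * δ₁ ≤ 1 / 10)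
    {CT : ℝ} (hCT : 0 ≤ CT) (hCTb : ∀ l : SiteL2K ℂ 3 (periodsT3 F K) c₀ W₂, ‖ι (Q'' l)‖ ≤ CT * ‖l‖)
    {CG : ℝ} (hCG : 0 ≤ CG) (hGn : ∀ f, ‖G f‖ ≤ CG * ‖f‖)
    {mB : ℝ} (hmB : 0 < mB) (hcoer : ∀ f : SiteL2K ℂ 3 (periodsT3 F n) c₁ W₂, mB * ‖f‖ ≤ ‖G (T f)‖)
    (hgap : 3 * ((Real.sqrt (max 2 (16 * c₀ * ((F.L : ℝ) ^ (K - n)) ^ 3 / (a * c₁))) * (2 + Real.sqrt (max 2 (16 * c₀ * ((F.L : ℝ) ^ (K - n)) ^ 3 / (a * c₁))))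
          * (Real.sqrt 3 * (eta F n K)⁻¹ * ρ + (Real.sqrt 3 * (eta F n K)⁻¹ * ρ) ^ 2 + Real.sqrt a * CT * ρ' + a * CT ^ 2 * ρ' ^ 2)
          * (8 * Real.sqrt (max 2 (16 * c₀ * ((F.L : ℝ) ^ (K - n)) ^ 3 / (a * c₁))) + 8 * Real.sqrt (max 2 (16 * c₀ * ((F.L : ℝ) ^ (K - n)) ^ 3 / (a * c₁))) ^ 2)
          * (CT * (1 + ρ')) + CG * (CT * ρ'))) ^ 2 < mB ^ 2 / 2)
    (i i' : ιc) (hi' : φc (yc i') = 0) :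
    ‖(Matrix.of fun i i' : ιc => ⟪G (T (bc i)), G (T (bc i'))⟫_ℂ)⁻¹ i i'‖
      ≤ (mB ^ 2 / 2 - 3 * ((Real.sqrt (max 2 (16 * c₀ * ((F.L : ℝ) ^ (K - n)) ^ 3 / (a * c₁))) * (2 + Real.sqrt (max 2 (16 * c₀ * ((F.L : ℝ) ^ (K - n)) ^ 3 / (a * c₁))))
          * (Real.sqrt 3 * (eta F n K)⁻¹ * ρ + (Real.sqrt 3 * (eta F n K)⁻¹ * ρ) ^ 2 + Real.sqrt a * CT * ρ' + a * CT ^ 2 * ρ' ^ 2)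
          * (8 * Real.sqrt (max 2 (16 * c₀ * ((F.L : ℝ) ^ (K - n)) ^ 3 / (a * c₁))) + 8 * Real.sqrt (max 2 (16 * c₀ * ((F.L : ℝ) ^ (K - n)) ^ 3 / (a * c₁))) ^ 2)
          * (CT * (1 + ρ')) + CG * (CT * ρ'))) ^ 2)⁻¹ * Real.exp (-(φc (yc i))) := by
  classical
  set B : Matrix ιf ιc ℂ := Matrix.of fun x i => ⟪bf x, G (T (bc i))⟫_ℂ with hB
  set ε : ℝ := (Real.sqrt (max 2 (16 * c₀ * ((F.L : ℝ) ^ (K - n)) ^ 3 / (a * c₁))) * (2 + Real.sqrt (max 2 (16 * c₀ * ((F.L : ℝ) ^ (K - n)) ^ 3 / (a * c₁))))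
          * (Real.sqrt 3 * (eta F n K)⁻¹ * ρ + (Real.sqrt 3 * (eta F n K)⁻¹ * ρ) ^ 2 + Real.sqrt a * CT * ρ' + a * CT ^ 2 * ρ' ^ 2)
          * (8 * Real.sqrt (max 2 (16 * c₀ * ((F.L : ℝ) ^ (K - n)) ^ 3 / (a * c₁))) + 8 * Real.sqrt (max 2 (16 * c₀ * ((F.L : ℝ) ^ (K - n)) ^ 3 / (a * c₁))) ^ 2)
          * (CT * (1 + ρ')) + CG * (CT * ρ')) with hε_def
  have hη : 0 < eta F n K := eta_pos F n K
  have hε0 : 0 ≤ ε := by rw [hε_def]; positivity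
  -- `M = Bᴴ B`
  have hM : (Matrix.of fun i i' : ιc => ⟪G (T (bc i)), G (T (bc i'))⟫_ℂ) = Bᴴ * B := by
    ext j j'
    rw [Matrix.of_apply, hB, gram_eq_conjTranspose_mul_coords bf (fun i => G (T (bc i))) j j']
  -- coercivity in coordinates
  have hcoer' : ∀ c' : ιc → ℂ, mB ^ 2 * ∑ i, ‖c' i‖ ^ 2 ≤ ∑ x, ‖(B *ᵥ c') x‖ ^ 2 := by
    intro c'
    have h1 : ∑ x, ‖(B *ᵥ c') x‖ ^ 2 = ‖G (T (∑ i, c' i • bc i))‖ ^ 2 := by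
      rw [← bf.sum_sq_norm_inner_right]
      exact Finset.sum_congr rfl fun x _ => by rw [hB, col_mulVec_eq_inner F T G bf bc c' x]
    rw [h1, ← norm_sq_sum_smul_orthonormalBasis bc c', ← mul_pow]
    exact pow_le_pow_left₀ (by positivity) (hcoer _) 2
  -- the two perturbation rows
  have hplus := hplus_of_weights F h hε₀ hε7 U₀ hreg Q'' hseq ι hι T hT ha G hAG bf xf hbf bc cpl yc hbc hcpl φ φc hρ hρ' hwρ hwρ' hδ₁ hδ hwin hCT hCTb hCG hGn
  have hwρm : ∀ b : PBond (F.P K) 0, |Real.exp (-φ b.tgt) / Real.exp (-φ b.src) - 1| ≤ ρ ∧ |Real.exp (-φ b.src) / Real.exp (-φ b.tgt) - 1| ≤ ρ := by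
    intro b
    have hq : ∀ s t : ℝ, Real.exp (-s) / Real.exp (-t) = Real.exp t / Real.exp s := fun s t => by
      rw [Real.exp_neg, Real.exp_neg, inv_div_inv]
    rw [hq, hq]; exact ⟨(hwρ b).2, (hwρ b).1⟩
  have hwρm' : ∀ x : Site (F.P K) 0, |Real.exp (-φ x) / Real.exp (-φc (iterBlockOf (K - n) x)) - 1| ≤ ρ' ∧
      |Real.exp (-φc (iterBlockOf (K - n) x)) / Real.exp (-φ x) - 1| ≤ ρ' := by
    intro x
    have hq : ∀ s t : ℝ, Real.exp (-s) / Real.exp (-t) = Real.exp t / Real.exp s := fun s t => by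
      rw [Real.exp_neg, Real.exp_neg, inv_div_inv]
    rw [hq, hq]; exact ⟨(hwρ' x).2, (hwρ' x).1⟩
  have hminus := hplus_of_weights F h hε₀ hε7 U₀ hreg Q'' hseq ι hι T hT ha G hAG bf xf hbf bc cpl yc hbc hcpl (fun s => -φ s) (fun y => -φc y) hρ hρ'
    hwρm hwρm' hδ₁ hδ hwin hCT hCTb hCG hGn
  have hmat : (Matrix.of fun x i => (Real.exp ((fun s => -φ s) (xf x) - (fun y => -φc y) (yc i)) : ℂ) * ⟪bf x, G (T (bc i))⟫_ℂ)
      = Matrix.of fun x i => (Real.exp (φc (yc i) - φ (xf x)) : ℂ) * B x i := by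
    ext x i; rw [Matrix.of_apply, Matrix.of_apply, hB, Matrix.of_apply]; ring_nf
  simp only [hmat] at hminus
  -- conclude
  have hmain := gram_inv_entry_decay B hM (fun x => φ (xf x)) (fun i => φc (yc i)) (m₀ := mB ^ 2) (ε := ε) (by positivity) hε0
    (by rw [hε_def]; exact hgap) hcoer' (fun c' => by rw [hε_def]; exact hplus c') (fun c' => by rw [hε_def]; exact hminus c') i i' hi'
  rw [hε_def] at hmain
  exact hmain

end Coordinates


end Summit.QuantumFields.YangMills.Theorems.Prop7CoarseGramInverseDecay

end
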